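import Summits.BirchSwinnertonDyer.BirchSwinnertonDyer.Theorems.BiquadraticEisensteinDescentHeegnerTwistCouplingInSupplyKrizLiCornerQT27
import Summits.BirchSwinnertonDyer.BirchSwinnertonDyer.Theorems.PrintCFramJZeroThreeUnitRegimePrimePairInstances
import Literature.NumberTheory.QuadraticFields.ImaginaryQuadraticClassNumberValues
import HarnessLib

set_option linter.dupNamespace false -- `Summit.BirchSwinnertonDyer.BirchSwinnertonDyer.Theorems.…` (summit = sub, D-0017)
set_option autoImplicit false

/-!
# Crux `HeegnerTwistCouplingInSupply` (stmt-BirchSwinnertonDyer-21381) — QT27₊ through the Kriz–Li door, TABLE III: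
# every KL3-regular prime `q ≡ 5 (mod 12)` with 797 ≤ q < 1000 — `q ∈ {797, 809, 821, 857, 881, 941, 977}`

Route `BiquadraticEisensteinDescent` (cell `pub/bsd-wall`, width seat `bsd-wall-cm-bed-w4` g27; `--supports` 21381, helper). Companion of
`…KrizLiCornerQT27.lean` (`exists_cruxConclusion_of_prime_pair`) / `…KrizLiCornerQT27Instances.lean` (q < 110). For each row ONE certificate prime `r ≡ 11 (mod 12)` with
`(−r/q) = +1`, `3 ∤ h(−qr)`, `h(−r) < q` (this seat's `work/py/qt27_rows2.py`), the two integer certificates `3 ∤ S₁(q,r)`, `3 ∥ S₂(q)` of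
Kriz–Li's Bernoulli hypothesis DECIDED in the kernel (Euler's criterion in `ℕ`, `RouteU.jacobiSym_prime_eq_ite_nat`; the largest sum here
has 56587 terms), and ★ `cruxOnQT27Plus_<q>`: the CONCLUSION of crux 21381 at `(W, q)` for every globally minimal
`W ≅ y² = x³ + q·m²` (bad primes `⊂ {3, q}`, `a₂ = 0` if good at `2`, `r_an(W) ≠ 0`) modulo the three named facts `hKL` (Kriz–Li 2019 Thm.
1.20), `hGZ` (Gross–Zagier), `hHP` (Heegner points). KL3-IRREGULAR `q ≡ 5 (12)` below `1000` (`3 ∣ h(−3q)`, corner void for this door):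
29, 113, 137, 173, 257, 281, 353, 401, 449, 461, 521, 653, 761, 773, 929, 953.

| `q` | `r` | `h(−r)` | terms of `S₁` |
|---|---|---|---|
| 797 | 71 | 7 | 56587 |
| 809 | 23 | 3 | 18607 |
| 821 | 23 | 3 | 18883 |
| 857 | 23 | 3 | 19711 |
| 881 | 11 | 1 | 9691 |
| 941 | 47 | 5 | 44227 |
| 977 | 47 | 5 | 45919 |

HONEST FRAMING: cells of ONE CM family; conditional on three REFEREED named facts; per-curve binders `hW`/`h6`/`h2`/`hS` displayed as in
the cell `bsd-print-cfram`'s class theorems; the crux (C⁺ / (S3′)(p) for all `p`), its registered stubs and BSD are NOT proved by any of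
this. THEOREMS ONLY. Supports stmt-BirchSwinnertonDyer-21381.
[cite: KrizLi2019, Thm. 1.20 (pp. 7–8), §1.5 (1)] [cite: Washington1997, Thm. 4.2] [cite: GrossZagier1986, Thm. I.(6.3), V.§1–2]
[cite: Cox2013, §2.A Thm. 2.13; §7.B Thm. 7.7(ii)] [cite: IrelandRosen1990, Prop. 5.1.2 (Euler's criterion)]
-/

noncomputable section

open scoped Classical

namespace Summit.BirchSwinnertonDyer.BirchSwinnertonDyer.Theorems.KrizLiCornerQT27

open _root_.WeierstrassCurve NumberField
open Literature.NumberTheory.EllipticCurves Literature.NumberTheory.EllipticCurves.KrizLi2019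
  Literature.NumberTheory.EllipticCurves.ModularForms Literature.NumberTheory.QuadraticFields
  Literature.NumberTheory.QuadraticFields.Quadratic
  Summit.BirchSwinnertonDyer.Rank1Residual.X12.O11.RouteU
  Summit.BirchSwinnertonDyer.BirchSwinnertonDyer.Theorems.PrintCFram

/-! ## `(q, r) = (797, 71)` -/

set_option maxRecDepth 800000 in
/-- **CERTIFICATES for `(q, r) = (797, 71)`**: `3 ∤ S₁(797,71)` (56587 terms), `3 ∣ S₂(797)`, `9 ∤ S₂(797)` (`decide +kernel` on Euler's criterion).
[cite: KrizLi2019, Thm. 1.20 (p. 8) and §1.5 (1)] [cite: Washington1997, Thm. 4.2] -/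
theorem cert_797_71 :
    ¬ ((3 : ℤ) ∣ ∑ j ∈ Finset.range (797 * 71), jacobiSym (j : ℤ) 797 * jacobiSym (j : ℤ) 71 * (j : ℤ)) ∧
    ((3 : ℤ) ∣ ∑ j ∈ Finset.range (797 * 3), jacobiSym (j : ℤ) 797 * jacobiSym (j : ℤ) 3 * (j : ℤ) ^ (0 + 1)) ∧
    ¬ ((3 : ℤ) ^ 2 ∣ ∑ j ∈ Finset.range (797 * 3), jacobiSym (j : ℤ) 797 * jacobiSym (j : ℤ) 3 * (j : ℤ) ^ (0 + 1)) := by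
  simp_rw [jacobiSym_prime_eq_ite_nat 797 (by norm_num) (by norm_num), jacobiSym_prime_eq_ite_nat 71 (by norm_num) (by norm_num),
    jacobiSym_prime_eq_ite_nat 3 (by norm_num) (by norm_num)]
  refine ⟨?_, ?_, ?_⟩ <;> decide +kernel

/-- ★ **The QT27₊ corner at `q = 797`** (certificate `r = 71`, `h(−71) = 7 < 797`): for every globally minimal `W ≅ y² = x³ + 797·m²`
(`797m²` sixth-power-free; `27a^{(797)}` is `m = 3188`) with bad primes `⊂ {3, 797}`, `a₂(W) = 0` if good at `2`, `r_an(W) ≠ 0`: the CONCLUSION of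
crux 21381 at `(W, 797)`, modulo `hKL`, `hGZ`, `hHP` only. [cite: KrizLi2019, Thm. 1.20 (pp. 7–8)] [cite: GrossZagier1986, Thm. I.(6.3), V.§1–2] -/
theorem cruxOnQT27Plus_797 (hKL : thm120_padicLogHeegner_unit_of_bernoulli)
    (hGZ : ∀ (N : ℕ) [NeZero N] (W : WeierstrassCurve ℚ) (K : Type) [Field K] [NumberField K], gross_zagier N W K)
    (hHP : ∀ (W : WeierstrassCurve ℚ) (K : Type) [Field K] [NumberField K], exists_isHeegnerPoint W K)
    (W : WeierstrassCurve ℚ) [W.IsElliptic] [W.IsGloballyMinimal] [NeZero (W.conductorNorm ℤ)]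
    {m : ℤ} (hm : m ≠ 0) (hW : ∃ C : VariableChange ℚ, C • W = mordellCurve ((797 : ℚ) * (m : ℚ) ^ 2))
    (h6 : ∀ ℓ : ℕ, ℓ.Prime → ¬ ((ℓ : ℤ) ^ 6 ∣ (797 : ℤ) * m ^ 2))
    (h2 : (haveI : Fact (Nat.Prime 2) := ⟨Nat.prime_two⟩; W.HasGoodReductionAtPrime 2) → W.LFunction 2 = 0)
    (hS : ∀ ℓ : ℕ, (hℓ : ℓ.Prime) → ¬ (haveI := Fact.mk hℓ; W.HasGoodReductionAtPrime ℓ) → ℓ = 3 ∨ ℓ = 797)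
    (hr1 : W.analyticRank ≠ 0) :
    ∃ (K : Type) (_ : Field K) (_ : NumberField K),
      IsImaginaryQuadratic K ∧ 4 < (NumberField.discr K).natAbs ∧
      SatisfiesHeegnerHypothesis (W.conductorNorm ℤ) K ∧
      (W.quadraticTwist (NumberField.discr K : ℚ)).entireLFunction 1 ≠ 0 ∧ ¬ 797 ∣ NumberField.classNumber K := by
  haveI : Fact (Nat.Prime 797) := ⟨by norm_num⟩
  haveI : Fact (Nat.Prime 71) := ⟨by norm_num⟩
  exact exists_cruxConclusion_of_prime_pair hKL hGZ hHP (q := 797) (r := 71) (by norm_num) (by norm_num) (by norm_num)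
    (by norm_num) (by norm_num) (by norm_num)
    (by simp_rw [jacobiSym.legendreSym.to_jacobiSym]; exact cert_797_71.1)
    (by simp_rw [jacobiSym.legendreSym.to_jacobiSym]; exact cert_797_71.2.1)
    (by simp_rw [jacobiSym.legendreSym.to_jacobiSym]; exact cert_797_71.2.2)
    ClassNumberValues.classNumber_neg71 (by norm_num) W hm (by exact_mod_cast hW) (by exact_mod_cast h6) h2
    (fun ℓ hℓ hbad => (hS ℓ hℓ hbad).elim Or.inl fun h => Or.inr (Or.inl h)) hr1

/-! ## `(q, r) = (809, 23)` -/

set_option maxRecDepth 800000 in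
/-- **CERTIFICATES for `(q, r) = (809, 23)`**: `3 ∤ S₁(809,23)` (18607 terms), `3 ∣ S₂(809)`, `9 ∤ S₂(809)` (`decide +kernel` on Euler's criterion).
[cite: KrizLi2019, Thm. 1.20 (p. 8) and §1.5 (1)] [cite: Washington1997, Thm. 4.2] -/
theorem cert_809_23 :
    ¬ ((3 : ℤ) ∣ ∑ j ∈ Finset.range (809 * 23), jacobiSym (j : ℤ) 809 * jacobiSym (j : ℤ) 23 * (j : ℤ)) ∧
    ((3 : ℤ) ∣ ∑ j ∈ Finset.range (809 * 3), jacobiSym (j : ℤ) 809 * jacobiSym (j : ℤ) 3 * (j : ℤ) ^ (0 + 1)) ∧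
    ¬ ((3 : ℤ) ^ 2 ∣ ∑ j ∈ Finset.range (809 * 3), jacobiSym (j : ℤ) 809 * jacobiSym (j : ℤ) 3 * (j : ℤ) ^ (0 + 1)) := by
  simp_rw [jacobiSym_prime_eq_ite_nat 809 (by norm_num) (by norm_num), jacobiSym_prime_eq_ite_nat 23 (by norm_num) (by norm_num),
    jacobiSym_prime_eq_ite_nat 3 (by norm_num) (by norm_num)]
  refine ⟨?_, ?_, ?_⟩ <;> decide +kernel

/-- ★ **The QT27₊ corner at `q = 809`** (certificate `r = 23`, `h(−23) = 3 < 809`): for every globally minimal `W ≅ y² = x³ + 809·m²`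
(`809m²` sixth-power-free; `27a^{(809)}` is `m = 3236`) with bad primes `⊂ {3, 809}`, `a₂(W) = 0` if good at `2`, `r_an(W) ≠ 0`: the CONCLUSION of
crux 21381 at `(W, 809)`, modulo `hKL`, `hGZ`, `hHP` only. [cite: KrizLi2019, Thm. 1.20 (pp. 7–8)] [cite: GrossZagier1986, Thm. I.(6.3), V.§1–2] -/
theorem cruxOnQT27Plus_809 (hKL : thm120_padicLogHeegner_unit_of_bernoulli)
    (hGZ : ∀ (N : ℕ) [NeZero N] (W : WeierstrassCurve ℚ) (K : Type) [Field K] [NumberField K], gross_zagier N W K)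
    (hHP : ∀ (W : WeierstrassCurve ℚ) (K : Type) [Field K] [NumberField K], exists_isHeegnerPoint W K)
    (W : WeierstrassCurve ℚ) [W.IsElliptic] [W.IsGloballyMinimal] [NeZero (W.conductorNorm ℤ)]
    {m : ℤ} (hm : m ≠ 0) (hW : ∃ C : VariableChange ℚ, C • W = mordellCurve ((809 : ℚ) * (m : ℚ) ^ 2))
    (h6 : ∀ ℓ : ℕ, ℓ.Prime → ¬ ((ℓ : ℤ) ^ 6 ∣ (809 : ℤ) * m ^ 2))
    (h2 : (haveI : Fact (Nat.Prime 2) := ⟨Nat.prime_two⟩; W.HasGoodReductionAtPrime 2) → W.LFunction 2 = 0)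
    (hS : ∀ ℓ : ℕ, (hℓ : ℓ.Prime) → ¬ (haveI := Fact.mk hℓ; W.HasGoodReductionAtPrime ℓ) → ℓ = 3 ∨ ℓ = 809)
    (hr1 : W.analyticRank ≠ 0) :
    ∃ (K : Type) (_ : Field K) (_ : NumberField K),
      IsImaginaryQuadratic K ∧ 4 < (NumberField.discr K).natAbs ∧
      SatisfiesHeegnerHypothesis (W.conductorNorm ℤ) K ∧
      (W.quadraticTwist (NumberField.discr K : ℚ)).entireLFunction 1 ≠ 0 ∧ ¬ 809 ∣ NumberField.classNumber K := by
  haveI : Fact (Nat.Prime 809) := ⟨by norm_num⟩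
  haveI : Fact (Nat.Prime 23) := ⟨by norm_num⟩
  exact exists_cruxConclusion_of_prime_pair hKL hGZ hHP (q := 809) (r := 23) (by norm_num) (by norm_num) (by norm_num)
    (by norm_num) (by norm_num) (by norm_num)
    (by simp_rw [jacobiSym.legendreSym.to_jacobiSym]; exact cert_809_23.1)
    (by simp_rw [jacobiSym.legendreSym.to_jacobiSym]; exact cert_809_23.2.1)
    (by simp_rw [jacobiSym.legendreSym.to_jacobiSym]; exact cert_809_23.2.2)
    ClassNumberValues.classNumber_neg23 (by norm_num) W hm (by exact_mod_cast hW) (by exact_mod_cast h6) h2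
    (fun ℓ hℓ hbad => (hS ℓ hℓ hbad).elim Or.inl fun h => Or.inr (Or.inl h)) hr1

/-! ## `(q, r) = (821, 23)` -/

set_option maxRecDepth 800000 in
/-- **CERTIFICATES for `(q, r) = (821, 23)`**: `3 ∤ S₁(821,23)` (18883 terms), `3 ∣ S₂(821)`, `9 ∤ S₂(821)` (`decide +kernel` on Euler's criterion).
[cite: KrizLi2019, Thm. 1.20 (p. 8) and §1.5 (1)] [cite: Washington1997, Thm. 4.2] -/
theorem cert_821_23 :
    ¬ ((3 : ℤ) ∣ ∑ j ∈ Finset.range (821 * 23), jacobiSym (j : ℤ) 821 * jacobiSym (j : ℤ) 23 * (j : ℤ)) ∧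
    ((3 : ℤ) ∣ ∑ j ∈ Finset.range (821 * 3), jacobiSym (j : ℤ) 821 * jacobiSym (j : ℤ) 3 * (j : ℤ) ^ (0 + 1)) ∧
    ¬ ((3 : ℤ) ^ 2 ∣ ∑ j ∈ Finset.range (821 * 3), jacobiSym (j : ℤ) 821 * jacobiSym (j : ℤ) 3 * (j : ℤ) ^ (0 + 1)) := by
  simp_rw [jacobiSym_prime_eq_ite_nat 821 (by norm_num) (by norm_num), jacobiSym_prime_eq_ite_nat 23 (by norm_num) (by norm_num),
    jacobiSym_prime_eq_ite_nat 3 (by norm_num) (by norm_num)]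
  refine ⟨?_, ?_, ?_⟩ <;> decide +kernel

/-- ★ **The QT27₊ corner at `q = 821`** (certificate `r = 23`, `h(−23) = 3 < 821`): for every globally minimal `W ≅ y² = x³ + 821·m²`
(`821m²` sixth-power-free; `27a^{(821)}` is `m = 3284`) with bad primes `⊂ {3, 821}`, `a₂(W) = 0` if good at `2`, `r_an(W) ≠ 0`: the CONCLUSION of
crux 21381 at `(W, 821)`, modulo `hKL`, `hGZ`, `hHP` only. [cite: KrizLi2019, Thm. 1.20 (pp. 7–8)] [cite: GrossZagier1986, Thm. I.(6.3), V.§1–2] -/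
theorem cruxOnQT27Plus_821 (hKL : thm120_padicLogHeegner_unit_of_bernoulli)
    (hGZ : ∀ (N : ℕ) [NeZero N] (W : WeierstrassCurve ℚ) (K : Type) [Field K] [NumberField K], gross_zagier N W K)
    (hHP : ∀ (W : WeierstrassCurve ℚ) (K : Type) [Field K] [NumberField K], exists_isHeegnerPoint W K)
    (W : WeierstrassCurve ℚ) [W.IsElliptic] [W.IsGloballyMinimal] [NeZero (W.conductorNorm ℤ)]
    {m : ℤ} (hm : m ≠ 0) (hW : ∃ C : VariableChange ℚ, C • W = mordellCurve ((821 : ℚ) * (m : ℚ) ^ 2))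
    (h6 : ∀ ℓ : ℕ, ℓ.Prime → ¬ ((ℓ : ℤ) ^ 6 ∣ (821 : ℤ) * m ^ 2))
    (h2 : (haveI : Fact (Nat.Prime 2) := ⟨Nat.prime_two⟩; W.HasGoodReductionAtPrime 2) → W.LFunction 2 = 0)
    (hS : ∀ ℓ : ℕ, (hℓ : ℓ.Prime) → ¬ (haveI := Fact.mk hℓ; W.HasGoodReductionAtPrime ℓ) → ℓ = 3 ∨ ℓ = 821)
    (hr1 : W.analyticRank ≠ 0) :
    ∃ (K : Type) (_ : Field K) (_ : NumberField K),
      IsImaginaryQuadratic K ∧ 4 < (NumberField.discr K).natAbs ∧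
      SatisfiesHeegnerHypothesis (W.conductorNorm ℤ) K ∧
      (W.quadraticTwist (NumberField.discr K : ℚ)).entireLFunction 1 ≠ 0 ∧ ¬ 821 ∣ NumberField.classNumber K := by
  haveI : Fact (Nat.Prime 821) := ⟨by norm_num⟩
  haveI : Fact (Nat.Prime 23) := ⟨by norm_num⟩
  exact exists_cruxConclusion_of_prime_pair hKL hGZ hHP (q := 821) (r := 23) (by norm_num) (by norm_num) (by norm_num)
    (by norm_num) (by norm_num) (by norm_num)
    (by simp_rw [jacobiSym.legendreSym.to_jacobiSym]; exact cert_821_23.1)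
    (by simp_rw [jacobiSym.legendreSym.to_jacobiSym]; exact cert_821_23.2.1)
    (by simp_rw [jacobiSym.legendreSym.to_jacobiSym]; exact cert_821_23.2.2)
    ClassNumberValues.classNumber_neg23 (by norm_num) W hm (by exact_mod_cast hW) (by exact_mod_cast h6) h2
    (fun ℓ hℓ hbad => (hS ℓ hℓ hbad).elim Or.inl fun h => Or.inr (Or.inl h)) hr1

/-! ## `(q, r) = (857, 23)` -/

set_option maxRecDepth 800000 in
/-- **CERTIFICATES for `(q, r) = (857, 23)`**: `3 ∤ S₁(857,23)` (19711 terms), `3 ∣ S₂(857)`, `9 ∤ S₂(857)` (`decide +kernel` on Euler's criterion).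
[cite: KrizLi2019, Thm. 1.20 (p. 8) and §1.5 (1)] [cite: Washington1997, Thm. 4.2] -/
theorem cert_857_23 :
    ¬ ((3 : ℤ) ∣ ∑ j ∈ Finset.range (857 * 23), jacobiSym (j : ℤ) 857 * jacobiSym (j : ℤ) 23 * (j : ℤ)) ∧
    ((3 : ℤ) ∣ ∑ j ∈ Finset.range (857 * 3), jacobiSym (j : ℤ) 857 * jacobiSym (j : ℤ) 3 * (j : ℤ) ^ (0 + 1)) ∧
    ¬ ((3 : ℤ) ^ 2 ∣ ∑ j ∈ Finset.range (857 * 3), jacobiSym (j : ℤ) 857 * jacobiSym (j : ℤ) 3 * (j : ℤ) ^ (0 + 1)) := by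
  simp_rw [jacobiSym_prime_eq_ite_nat 857 (by norm_num) (by norm_num), jacobiSym_prime_eq_ite_nat 23 (by norm_num) (by norm_num),
    jacobiSym_prime_eq_ite_nat 3 (by norm_num) (by norm_num)]
  refine ⟨?_, ?_, ?_⟩ <;> decide +kernel

/-- ★ **The QT27₊ corner at `q = 857`** (certificate `r = 23`, `h(−23) = 3 < 857`): for every globally minimal `W ≅ y² = x³ + 857·m²`
(`857m²` sixth-power-free; `27a^{(857)}` is `m = 3428`) with bad primes `⊂ {3, 857}`, `a₂(W) = 0` if good at `2`, `r_an(W) ≠ 0`: the CONCLUSION of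
crux 21381 at `(W, 857)`, modulo `hKL`, `hGZ`, `hHP` only. [cite: KrizLi2019, Thm. 1.20 (pp. 7–8)] [cite: GrossZagier1986, Thm. I.(6.3), V.§1–2] -/
theorem cruxOnQT27Plus_857 (hKL : thm120_padicLogHeegner_unit_of_bernoulli)
    (hGZ : ∀ (N : ℕ) [NeZero N] (W : WeierstrassCurve ℚ) (K : Type) [Field K] [NumberField K], gross_zagier N W K)
    (hHP : ∀ (W : WeierstrassCurve ℚ) (K : Type) [Field K] [NumberField K], exists_isHeegnerPoint W K)
    (W : WeierstrassCurve ℚ) [W.IsElliptic] [W.IsGloballyMinimal] [NeZero (W.conductorNorm ℤ)]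
    {m : ℤ} (hm : m ≠ 0) (hW : ∃ C : VariableChange ℚ, C • W = mordellCurve ((857 : ℚ) * (m : ℚ) ^ 2))
    (h6 : ∀ ℓ : ℕ, ℓ.Prime → ¬ ((ℓ : ℤ) ^ 6 ∣ (857 : ℤ) * m ^ 2))
    (h2 : (haveI : Fact (Nat.Prime 2) := ⟨Nat.prime_two⟩; W.HasGoodReductionAtPrime 2) → W.LFunction 2 = 0)
    (hS : ∀ ℓ : ℕ, (hℓ : ℓ.Prime) → ¬ (haveI := Fact.mk hℓ; W.HasGoodReductionAtPrime ℓ) → ℓ = 3 ∨ ℓ = 857)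
    (hr1 : W.analyticRank ≠ 0) :
    ∃ (K : Type) (_ : Field K) (_ : NumberField K),
      IsImaginaryQuadratic K ∧ 4 < (NumberField.discr K).natAbs ∧
      SatisfiesHeegnerHypothesis (W.conductorNorm ℤ) K ∧
      (W.quadraticTwist (NumberField.discr K : ℚ)).entireLFunction 1 ≠ 0 ∧ ¬ 857 ∣ NumberField.classNumber K := by
  haveI : Fact (Nat.Prime 857) := ⟨by norm_num⟩
  haveI : Fact (Nat.Prime 23) := ⟨by norm_num⟩
  exact exists_cruxConclusion_of_prime_pair hKL hGZ hHP (q := 857) (r := 23) (by norm_num) (by norm_num) (by norm_num)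
    (by norm_num) (by norm_num) (by norm_num)
    (by simp_rw [jacobiSym.legendreSym.to_jacobiSym]; exact cert_857_23.1)
    (by simp_rw [jacobiSym.legendreSym.to_jacobiSym]; exact cert_857_23.2.1)
    (by simp_rw [jacobiSym.legendreSym.to_jacobiSym]; exact cert_857_23.2.2)
    ClassNumberValues.classNumber_neg23 (by norm_num) W hm (by exact_mod_cast hW) (by exact_mod_cast h6) h2
    (fun ℓ hℓ hbad => (hS ℓ hℓ hbad).elim Or.inl fun h => Or.inr (Or.inl h)) hr1

/-! ## `(q, r) = (881, 11)` -/

set_option maxRecDepth 800000 in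
/-- **CERTIFICATES for `(q, r) = (881, 11)`**: `3 ∤ S₁(881,11)` (9691 terms), `3 ∣ S₂(881)`, `9 ∤ S₂(881)` (`decide +kernel` on Euler's criterion).
[cite: KrizLi2019, Thm. 1.20 (p. 8) and §1.5 (1)] [cite: Washington1997, Thm. 4.2] -/
theorem cert_881_11 :
    ¬ ((3 : ℤ) ∣ ∑ j ∈ Finset.range (881 * 11), jacobiSym (j : ℤ) 881 * jacobiSym (j : ℤ) 11 * (j : ℤ)) ∧
    ((3 : ℤ) ∣ ∑ j ∈ Finset.range (881 * 3), jacobiSym (j : ℤ) 881 * jacobiSym (j : ℤ) 3 * (j : ℤ) ^ (0 + 1)) ∧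
    ¬ ((3 : ℤ) ^ 2 ∣ ∑ j ∈ Finset.range (881 * 3), jacobiSym (j : ℤ) 881 * jacobiSym (j : ℤ) 3 * (j : ℤ) ^ (0 + 1)) := by
  simp_rw [jacobiSym_prime_eq_ite_nat 881 (by norm_num) (by norm_num), jacobiSym_prime_eq_ite_nat 11 (by norm_num) (by norm_num),
    jacobiSym_prime_eq_ite_nat 3 (by norm_num) (by norm_num)]
  refine ⟨?_, ?_, ?_⟩ <;> decide +kernel

/-- ★ **The QT27₊ corner at `q = 881`** (certificate `r = 11`, `h(−11) = 1 < 881`): for every globally minimal `W ≅ y² = x³ + 881·m²`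
(`881m²` sixth-power-free; `27a^{(881)}` is `m = 3524`) with bad primes `⊂ {3, 881}`, `a₂(W) = 0` if good at `2`, `r_an(W) ≠ 0`: the CONCLUSION of
crux 21381 at `(W, 881)`, modulo `hKL`, `hGZ`, `hHP` only. [cite: KrizLi2019, Thm. 1.20 (pp. 7–8)] [cite: GrossZagier1986, Thm. I.(6.3), V.§1–2] -/
theorem cruxOnQT27Plus_881 (hKL : thm120_padicLogHeegner_unit_of_bernoulli)
    (hGZ : ∀ (N : ℕ) [NeZero N] (W : WeierstrassCurve ℚ) (K : Type) [Field K] [NumberField K], gross_zagier N W K)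
    (hHP : ∀ (W : WeierstrassCurve ℚ) (K : Type) [Field K] [NumberField K], exists_isHeegnerPoint W K)
    (W : WeierstrassCurve ℚ) [W.IsElliptic] [W.IsGloballyMinimal] [NeZero (W.conductorNorm ℤ)]
    {m : ℤ} (hm : m ≠ 0) (hW : ∃ C : VariableChange ℚ, C • W = mordellCurve ((881 : ℚ) * (m : ℚ) ^ 2))
    (h6 : ∀ ℓ : ℕ, ℓ.Prime → ¬ ((ℓ : ℤ) ^ 6 ∣ (881 : ℤ) * m ^ 2))
    (h2 : (haveI : Fact (Nat.Prime 2) := ⟨Nat.prime_two⟩; W.HasGoodReductionAtPrime 2) → W.LFunction 2 = 0)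
    (hS : ∀ ℓ : ℕ, (hℓ : ℓ.Prime) → ¬ (haveI := Fact.mk hℓ; W.HasGoodReductionAtPrime ℓ) → ℓ = 3 ∨ ℓ = 881)
    (hr1 : W.analyticRank ≠ 0) :
    ∃ (K : Type) (_ : Field K) (_ : NumberField K),
      IsImaginaryQuadratic K ∧ 4 < (NumberField.discr K).natAbs ∧
      SatisfiesHeegnerHypothesis (W.conductorNorm ℤ) K ∧
      (W.quadraticTwist (NumberField.discr K : ℚ)).entireLFunction 1 ≠ 0 ∧ ¬ 881 ∣ NumberField.classNumber K := by
  haveI : Fact (Nat.Prime 881) := ⟨by norm_num⟩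
  haveI : Fact (Nat.Prime 11) := ⟨by norm_num⟩
  exact exists_cruxConclusion_of_prime_pair hKL hGZ hHP (q := 881) (r := 11) (by norm_num) (by norm_num) (by norm_num)
    (by norm_num) (by norm_num) (by norm_num)
    (by simp_rw [jacobiSym.legendreSym.to_jacobiSym]; exact cert_881_11.1)
    (by simp_rw [jacobiSym.legendreSym.to_jacobiSym]; exact cert_881_11.2.1)
    (by simp_rw [jacobiSym.legendreSym.to_jacobiSym]; exact cert_881_11.2.2)
    ClassNumberValues.classNumber_neg11 (by norm_num) W hm (by exact_mod_cast hW) (by exact_mod_cast h6) h2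
    (fun ℓ hℓ hbad => (hS ℓ hℓ hbad).elim Or.inl fun h => Or.inr (Or.inl h)) hr1

/-! ## `(q, r) = (941, 47)` -/

set_option maxRecDepth 800000 in
/-- **CERTIFICATES for `(q, r) = (941, 47)`**: `3 ∤ S₁(941,47)` (44227 terms), `3 ∣ S₂(941)`, `9 ∤ S₂(941)` (`decide +kernel` on Euler's criterion).
[cite: KrizLi2019, Thm. 1.20 (p. 8) and §1.5 (1)] [cite: Washington1997, Thm. 4.2] -/
theorem cert_941_47 :
    ¬ ((3 : ℤ) ∣ ∑ j ∈ Finset.range (941 * 47), jacobiSym (j : ℤ) 941 * jacobiSym (j : ℤ) 47 * (j : ℤ)) ∧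
    ((3 : ℤ) ∣ ∑ j ∈ Finset.range (941 * 3), jacobiSym (j : ℤ) 941 * jacobiSym (j : ℤ) 3 * (j : ℤ) ^ (0 + 1)) ∧
    ¬ ((3 : ℤ) ^ 2 ∣ ∑ j ∈ Finset.range (941 * 3), jacobiSym (j : ℤ) 941 * jacobiSym (j : ℤ) 3 * (j : ℤ) ^ (0 + 1)) := by
  simp_rw [jacobiSym_prime_eq_ite_nat 941 (by norm_num) (by norm_num), jacobiSym_prime_eq_ite_nat 47 (by norm_num) (by norm_num),
    jacobiSym_prime_eq_ite_nat 3 (by norm_num) (by norm_num)]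
  refine ⟨?_, ?_, ?_⟩ <;> decide +kernel

/-- ★ **The QT27₊ corner at `q = 941`** (certificate `r = 47`, `h(−47) = 5 < 941`): for every globally minimal `W ≅ y² = x³ + 941·m²`
(`941m²` sixth-power-free; `27a^{(941)}` is `m = 3764`) with bad primes `⊂ {3, 941}`, `a₂(W) = 0` if good at `2`, `r_an(W) ≠ 0`: the CONCLUSION of
crux 21381 at `(W, 941)`, modulo `hKL`, `hGZ`, `hHP` only. [cite: KrizLi2019, Thm. 1.20 (pp. 7–8)] [cite: GrossZagier1986, Thm. I.(6.3), V.§1–2] -/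
theorem cruxOnQT27Plus_941 (hKL : thm120_padicLogHeegner_unit_of_bernoulli)
    (hGZ : ∀ (N : ℕ) [NeZero N] (W : WeierstrassCurve ℚ) (K : Type) [Field K] [NumberField K], gross_zagier N W K)
    (hHP : ∀ (W : WeierstrassCurve ℚ) (K : Type) [Field K] [NumberField K], exists_isHeegnerPoint W K)
    (W : WeierstrassCurve ℚ) [W.IsElliptic] [W.IsGloballyMinimal] [NeZero (W.conductorNorm ℤ)]
    {m : ℤ} (hm : m ≠ 0) (hW : ∃ C : VariableChange ℚ, C • W = mordellCurve ((941 : ℚ) * (m : ℚ) ^ 2))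
    (h6 : ∀ ℓ : ℕ, ℓ.Prime → ¬ ((ℓ : ℤ) ^ 6 ∣ (941 : ℤ) * m ^ 2))
    (h2 : (haveI : Fact (Nat.Prime 2) := ⟨Nat.prime_two⟩; W.HasGoodReductionAtPrime 2) → W.LFunction 2 = 0)
    (hS : ∀ ℓ : ℕ, (hℓ : ℓ.Prime) → ¬ (haveI := Fact.mk hℓ; W.HasGoodReductionAtPrime ℓ) → ℓ = 3 ∨ ℓ = 941)
    (hr1 : W.analyticRank ≠ 0) :
    ∃ (K : Type) (_ : Field K) (_ : NumberField K),
      IsImaginaryQuadratic K ∧ 4 < (NumberField.discr K).natAbs ∧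
      SatisfiesHeegnerHypothesis (W.conductorNorm ℤ) K ∧
      (W.quadraticTwist (NumberField.discr K : ℚ)).entireLFunction 1 ≠ 0 ∧ ¬ 941 ∣ NumberField.classNumber K := by
  haveI : Fact (Nat.Prime 941) := ⟨by norm_num⟩
  haveI : Fact (Nat.Prime 47) := ⟨by norm_num⟩
  exact exists_cruxConclusion_of_prime_pair hKL hGZ hHP (q := 941) (r := 47) (by norm_num) (by norm_num) (by norm_num)
    (by norm_num) (by norm_num) (by norm_num)
    (by simp_rw [jacobiSym.legendreSym.to_jacobiSym]; exact cert_941_47.1)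
    (by simp_rw [jacobiSym.legendreSym.to_jacobiSym]; exact cert_941_47.2.1)
    (by simp_rw [jacobiSym.legendreSym.to_jacobiSym]; exact cert_941_47.2.2)
    ClassNumberValues.classNumber_neg47 (by norm_num) W hm (by exact_mod_cast hW) (by exact_mod_cast h6) h2
    (fun ℓ hℓ hbad => (hS ℓ hℓ hbad).elim Or.inl fun h => Or.inr (Or.inl h)) hr1

/-! ## `(q, r) = (977, 47)` -/

set_option maxRecDepth 800000 in
/-- **CERTIFICATES for `(q, r) = (977, 47)`**: `3 ∤ S₁(977,47)` (45919 terms), `3 ∣ S₂(977)`, `9 ∤ S₂(977)` (`decide +kernel` on Euler's criterion).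
[cite: KrizLi2019, Thm. 1.20 (p. 8) and §1.5 (1)] [cite: Washington1997, Thm. 4.2] -/
theorem cert_977_47 :
    ¬ ((3 : ℤ) ∣ ∑ j ∈ Finset.range (977 * 47), jacobiSym (j : ℤ) 977 * jacobiSym (j : ℤ) 47 * (j : ℤ)) ∧
    ((3 : ℤ) ∣ ∑ j ∈ Finset.range (977 * 3), jacobiSym (j : ℤ) 977 * jacobiSym (j : ℤ) 3 * (j : ℤ) ^ (0 + 1)) ∧
    ¬ ((3 : ℤ) ^ 2 ∣ ∑ j ∈ Finset.range (977 * 3), jacobiSym (j : ℤ) 977 * jacobiSym (j : ℤ) 3 * (j : ℤ) ^ (0 + 1)) := by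
  simp_rw [jacobiSym_prime_eq_ite_nat 977 (by norm_num) (by norm_num), jacobiSym_prime_eq_ite_nat 47 (by norm_num) (by norm_num),
    jacobiSym_prime_eq_ite_nat 3 (by norm_num) (by norm_num)]
  refine ⟨?_, ?_, ?_⟩ <;> decide +kernel

/-- ★ **The QT27₊ corner at `q = 977`** (certificate `r = 47`, `h(−47) = 5 < 977`): for every globally minimal `W ≅ y² = x³ + 977·m²`
(`977m²` sixth-power-free; `27a^{(977)}` is `m = 3908`) with bad primes `⊂ {3, 977}`, `a₂(W) = 0` if good at `2`, `r_an(W) ≠ 0`: the CONCLUSION of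
crux 21381 at `(W, 977)`, modulo `hKL`, `hGZ`, `hHP` only. [cite: KrizLi2019, Thm. 1.20 (pp. 7–8)] [cite: GrossZagier1986, Thm. I.(6.3), V.§1–2] -/
theorem cruxOnQT27Plus_977 (hKL : thm120_padicLogHeegner_unit_of_bernoulli)
    (hGZ : ∀ (N : ℕ) [NeZero N] (W : WeierstrassCurve ℚ) (K : Type) [Field K] [NumberField K], gross_zagier N W K)
    (hHP : ∀ (W : WeierstrassCurve ℚ) (K : Type) [Field K] [NumberField K], exists_isHeegnerPoint W K)
    (W : WeierstrassCurve ℚ) [W.IsElliptic] [W.IsGloballyMinimal] [NeZero (W.conductorNorm ℤ)]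
    {m : ℤ} (hm : m ≠ 0) (hW : ∃ C : VariableChange ℚ, C • W = mordellCurve ((977 : ℚ) * (m : ℚ) ^ 2))
    (h6 : ∀ ℓ : ℕ, ℓ.Prime → ¬ ((ℓ : ℤ) ^ 6 ∣ (977 : ℤ) * m ^ 2))
    (h2 : (haveI : Fact (Nat.Prime 2) := ⟨Nat.prime_two⟩; W.HasGoodReductionAtPrime 2) → W.LFunction 2 = 0)
    (hS : ∀ ℓ : ℕ, (hℓ : ℓ.Prime) → ¬ (haveI := Fact.mk hℓ; W.HasGoodReductionAtPrime ℓ) → ℓ = 3 ∨ ℓ = 977)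
    (hr1 : W.analyticRank ≠ 0) :
    ∃ (K : Type) (_ : Field K) (_ : NumberField K),
      IsImaginaryQuadratic K ∧ 4 < (NumberField.discr K).natAbs ∧
      SatisfiesHeegnerHypothesis (W.conductorNorm ℤ) K ∧
      (W.quadraticTwist (NumberField.discr K : ℚ)).entireLFunction 1 ≠ 0 ∧ ¬ 977 ∣ NumberField.classNumber K := by
  haveI : Fact (Nat.Prime 977) := ⟨by norm_num⟩
  haveI : Fact (Nat.Prime 47) := ⟨by norm_num⟩
  exact exists_cruxConclusion_of_prime_pair hKL hGZ hHP (q := 977) (r := 47) (by norm_num) (by norm_num) (by norm_num)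
    (by norm_num) (by norm_num) (by norm_num)
    (by simp_rw [jacobiSym.legendreSym.to_jacobiSym]; exact cert_977_47.1)
    (by simp_rw [jacobiSym.legendreSym.to_jacobiSym]; exact cert_977_47.2.1)
    (by simp_rw [jacobiSym.legendreSym.to_jacobiSym]; exact cert_977_47.2.2)
    ClassNumberValues.classNumber_neg47 (by norm_num) W hm (by exact_mod_cast hW) (by exact_mod_cast h6) h2
    (fun ℓ hℓ hbad => (hS ℓ hℓ hbad).elim Or.inl fun h => Or.inr (Or.inl h)) hr1

end Summit.BirchSwinnertonDyer.BirchSwinnertonDyer.Theorems.KrizLiCornerQT27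

end
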